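import Summits.KontsevichZagierPeriods.KontsevichZagierPeriods.Theses.IsogenyCertificates
import Summits.KontsevichZagierPeriods.KontsevichZagierPeriods.Theorems.SymplecticScissorsRealOnePeriodRelationsConditional
import Summits.KontsevichZagierPeriods.KontsevichZagierPeriods.Theorems.SymplecticScissorsPlanarAreasStubSwap
import Summits.KontsevichZagierPeriods.KontsevichZagierPeriods.Theorems.SymplecticScissorsPlanarAreasStubFibreDerivSemialgebraic
import Summits.KontsevichZagierPeriods.KontsevichZagierPeriods.Theorems.SymplecticScissorsPlanarAreasStubMixedPartials
import Summits.KontsevichZagierPeriods.KontsevichZagierPeriods.Theorems.SymplecticScissorsPlanarAreasStubDerivIntegrable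
import Summits.KontsevichZagierPeriods.KontsevichZagierPeriods.Theorems.IsogenyCertificatesGenusTwoRealPeriodCellStubBandNewtonLeibniz
import Summits.KontsevichZagierPeriods.KontsevichZagierPeriods.Theorems.FermatIsogenyBetaLinearSectorGreen
import Literature.NumberTheory.Transcendental.CurvePeriods

/-!
# `GenusTwoRealPeriodCell` (stmt-KontsevichZagierPeriods-17657) — line `Sketch` (HW transport), lead skeleton

The crux (route `IsogenyCertificates`, rank 7): Conjecture 1 in kernel form on the sector of complete
real half-periods of genus-2 curves over `ℚ`.

Line: every generator of the sector is a ONE-dimensional representation, so the crux is the genus-two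
layer of the sibling crux `RealOnePeriodRelations` (stmt-10042, "Huber–Wüstholz in real clothes"),
which is LANDED conditionally on the named fact `HuberWustholzCurvePeriods`
(`realOnePeriodRelations_of_huberWustholzCurvePeriods`): a vanishing combination lies in
`M₁ = closure (1a ∪ 1b ∪ 2 ∪ Green)`, and `M₁ ≤ KZ.relations` as soon as the typed GREEN GENERATOR lies
in `KZ.relations` (`greenSet ⊆ relations`, the open glue stub of crux `PlanarAreas` stmt-4990, whose
five analytic stubs are landed). So the skeleton is

`GenusTwoRealPeriodCell ⇐ HuberWustholzCurvePeriods (apex, named fact) + greenInRelations`,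
`greenInRelations ⇐ engine (Newton–Leibniz down a band off a null set) + landed PlanarAreas stubs`,
`engine ⇐ two-set adapted CAD fibre lemma + one NL move per sub-band + telescoping`.

Stubs: LANDED `stub_fibreEqTwo` (p144844), `stub_subband` (p146146), `stub_telescope` (p147795),
`stub_bandNLCell` (p148861), `stub_bandNewtonLeibniz` (p149230, the engine); `stub_greenOfEngine` = tree theorem
`BetaLinearSector.stub_greenInRelations_of_bandNewtonLeibniz` (no stub left); OPEN only
`stub_huberWustholzCurvePeriods` (XL apex = the named Literature fact, Huber–Wüstholz 2022 Thm 13.3 (2);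
NOT a worker target). Conditional closing file LANDING: …GenusTwoRealPeriodCellOfHuberWustholz.lean.

References: M. Kontsevich, D. Zagier, *Periods* (2001), §1.2; A. Huber, G. Wüstholz, *Transcendence
and linear relations of 1-periods* (2022), Thm 13.3 (2); S. Basu, R. Pollack, M.-F. Roy, *Algorithms
in Real Algebraic Geometry* (2006), Cor. 5.7.
-/

noncomputable section

open scoped BigOperators Topology
open Set MeasureTheory Filter
open Literature.NumberTheory.Transcendental
open Literature.ModelTheory.ExponentialFields (IsSemialgebraic IsCylindricalDecomposition graphOver
  bandOver bandLower bandUpper)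
open Summit.KontsevichZagierPeriods.SymplecticScissors.RealOnePeriodRelationsNegative (greenSet M₁ H₁ crux_iff)

namespace Summit.KontsevichZagierPeriods.IsogenyCertificates.GenusTwoRealPeriodCellLine

/-! ## Stubs -/

/-! LANDED stubs (imported, no longer declared here): `stub_fibreEqTwo` (p144844, …StubFibreEqTwo),
`stub_subband` (p146146, …StubSubband), `stub_telescope` (p147795, …StubTelescope), `stub_bandNLCell`
(p148861, …StubBandNLCell), `stub_bandNewtonLeibniz` (p149230, …StubBandNewtonLeibniz — the ENGINE). -/

/-! `stub_greenOfEngine` (Green from the engine) is a THEOREM OF THE TREE under another name: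
`FermatIsogeny.BetaLinearSector.stub_greenInRelations_of_bandNewtonLeibniz` (identical engine hypothesis;
landed 2026-08-17 by the parallel BetaLinearSector lead), and `greenSet ⊆ KZ.relations` itself is landed
as `FermatIsogeny.BetaLinearSector.greenInRelations` (their engine + this line's `stub_subband`). No Green
stub remains. -/

/-- **Green from the engine** (formerly the registered stub `stub_greenOfEngine`): the tree theorem
`BetaLinearSector.stub_greenInRelations_of_bandNewtonLeibniz`. [cite: KontsevichZagier2001, §1.2] -/
theorem greenOfEngine_holds :
    (∀ (a₀ a₁ : ℚ) (α β : ℝ → ℝ) (F : (Fin 2 → ℝ) → ℝ)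
      (Z : Set (Fin 2 → ℝ)) (r : KZ.IntegralRep 2), a₀ < a₁ →
      IsSemialgebraicFunOn ℚ {z : Fin 1 → ℝ | z 0 ∈ Set.Ioo (a₀ : ℝ) a₁} (fun z => α (z 0)) →
      IsSemialgebraicFunOn ℚ {z : Fin 1 → ℝ | z 0 ∈ Set.Ioo (a₀ : ℝ) a₁} (fun z => β (z 0)) →
      (∀ t ∈ Set.Ioo (a₀ : ℝ) a₁, α t ≤ β t) →
      r.domain = {p : Fin 2 → ℝ | p 0 ∈ Set.Icc (a₀ : ℝ) a₁ ∧ α (p 0) ≤ p 1 ∧ p 1 ≤ β (p 0)} →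
      IsSemialgebraicFunOn ℚ r.domain F → (∃ M : ℝ, ∀ p ∈ r.domain, |F p| ≤ M) →
      (∀ t ∈ Set.Ioo (a₀ : ℝ) a₁, ContinuousOn (fun s : ℝ => F ![t, s]) (Set.Icc (α t) (β t))) →
      IsSemialgebraic ℚ Z → volume Z = 0 →
      (∀ p ∈ r.domain, p 0 ∈ Set.Ioo (a₀ : ℝ) a₁ → α (p 0) < p 1 → p 1 < β (p 0) → p ∉ Z →
        HasDerivAt (fun s : ℝ => F ![p 0, s]) (r.integrand p) (p 1)) →
      ∃ r' : KZ.IntegralRep 1, r'.domain = {z : Fin 1 → ℝ | z 0 ∈ Set.Ioo (a₀ : ℝ) a₁} ∧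
        (∀ z ∈ r'.domain, r'.integrand z = F ![z 0, β (z 0)] - F ![z 0, α (z 0)]) ∧
        KZ.of r - KZ.of r' ∈ KZ.relations) →
    ∀ g ∈ greenSet, g ∈ KZ.relations :=
  Summit.KontsevichZagierPeriods.FermatIsogeny.BetaLinearSector.stub_greenInRelations_of_bandNewtonLeibniz

/-- **The apex (named fact, XL): Huber–Wüstholz 2022, Thm 13.3 (2)** — all `ℚ̄`-linear relations
among periods of curve type are induced by bilinearity and functoriality. This is the Literature
named fact `HuberWustholzCurvePeriods` (cite-only; proved in the tree for genus 0 and one non-CM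
elliptic curve only); it is the declared transcendence input of the crux and is carried here as the
single apex stub — the crux is CLOSED MODULO it once the other stubs land.
[cite: HuberWustholz2022, Thm 13.3 (2)] -/
theorem stub_huberWustholzCurvePeriods :
    Literature.NumberTheory.Transcendental.HuberWustholzCurvePeriods := by
  sorry

/-! ## Composition (sorry-free over the stubs) -/

/-- **The Green generator lies in `KZ.relations`** (glue over the engine). -/
theorem greenInRelations : ∀ g ∈ greenSet, g ∈ KZ.relations :=
  greenOfEngine_holds stub_bandNewtonLeibniz

/-- `M₁ = closure (1a ∪ 1b ∪ 2 ∪ Green) ≤ KZ.relations`. -/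
theorem M₁_le_relations (hG : ∀ g ∈ greenSet, g ∈ KZ.relations) : M₁ ≤ KZ.relations := by
  refine (AddSubgroup.closure_le _).mpr ?_
  rintro c (((hc | hc) | hc) | hc)
  · exact KZ.domainAddRel_subset_relations hc
  · exact KZ.integrandAddRel_subset_relations hc
  · exact KZ.changeOfVariablesRel_subset_relations hc
  · exact hG c hc

/-- **The crux, modulo the registered stubs**: every generator of the genus-two sector is a
one-dimensional representation, so a vanishing combination lies in `H₁ ∩ ker eval`, hence in `M₁` by
`RealOnePeriodRelations` (landed conditionally on the apex `HuberWustholzCurvePeriods`), hence in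
`KZ.relations` by `M₁ ≤ relations` (the Green glue). -/
theorem GenusTwoRealPeriodCell_of :
    Summit.KontsevichZagierPeriods.KontsevichZagierPeriods.Theses.IsogenyCertificates.GenusTwoRealPeriodCell := by
  intro c hc h0
  have hR := Summit.KontsevichZagierPeriods.SymplecticScissors.RealOnePeriodRelations.realOnePeriodRelations_of_huberWustholzCurvePeriods
    stub_huberWustholzCurvePeriods
  have hH : c ∈ H₁ := by
    refine AddSubgroup.closure_mono ?_ hc
    rintro d ⟨F, q, a₀, a₁, r, -, -, -, -, -, rfl⟩
    exact ⟨r, rfl⟩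
  exact M₁_le_relations greenInRelations ((crux_iff.mp hR) c hH h0)

/-- **The crux from the apex and the Green glue** (the same composition with both inputs as
hypotheses; this is the conditional theorem to be landed `--supports` once `greenInRelations` is a
theorem of the tree). -/
theorem cell_of (hHW : Literature.NumberTheory.Transcendental.HuberWustholzCurvePeriods)
    (hG : ∀ g ∈ greenSet, g ∈ KZ.relations) :
    Summit.KontsevichZagierPeriods.KontsevichZagierPeriods.Theses.IsogenyCertificates.GenusTwoRealPeriodCell := by
  intro c hc h0
  have hR := Summit.KontsevichZagierPeriods.SymplecticScissors.RealOnePeriodRelations.realOnePeriodRelations_of_huberWustholzCurvePeriods hHW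
  have hH : c ∈ H₁ := by
    refine AddSubgroup.closure_mono ?_ hc
    rintro d ⟨F, q, a₀, a₁, r, -, -, -, -, -, rfl⟩
    exact ⟨r, rfl⟩
  exact M₁_le_relations hG ((crux_iff.mp hR) c hH h0)

end Summit.KontsevichZagierPeriods.IsogenyCertificates.GenusTwoRealPeriodCellLine

end
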